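import Mathlib
import HarnessLib
import Summits.Parity.GeneralizedHardyLittlewood.Theorems.LiouvilleShiftedTablesEngineToPairsTIIOfX1Part4

/-!
# `stub_TII_of_X1`, part 5: the rectangle total and the band total (line `Sketch`)

Fifth file of the Type-II leaf of the correlation sieve for the crux `EngineToPairs`
(stmt-Parity-14659).  With `L = log x`, `η = L^{−C'}`, `X = x^{1/3+δ}`, the `(1+η)`-adic blocks of
part 4 (at most `3 L^{C'+1}` of them) and the family bound of part 2 at saving `K`:

* rectangles (`rect_total_le`): `∑_i ‖ξ|_{block i}‖ √(c₁ x L^{e₁}/((1+η)A_i)) · (1+L) √x L^{−K}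
  ≤ (1+L) √x L^{−K} · √(c₁ x L^{e₁}) · √(#blocks) · √(∑_m ξ_m²/m)` (Cauchy–Schwarz over the blocks,
  `m ≤ (1+η)A_i` on block `i`, `∑ τ(m)^{2B}/m ≪ L^{e₁}`), `≤ 2√(3c₁c₃) x L^{−A}` for
  `K = A + 1 + (2e₁ + C' + 1)/2`;
* bands (`band_final_le`): `∑_{k ∈ bands} τ(k−h) τ(k)^{2B+1} ≤ √(#bands) √(∑ (τ(k−h)⁴ + τ(k)^{8B+4})/2)
  ≤ √(c₈(c₅+c₆)/2) x L^{−A}` for `C' = ⌈2A⌉ + 32 + 2^{8B+5}`, using `#bands ≤ 2ηx + 2` and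
  `L^{C'} ≤ (C'+1)^{C'} x`.
-/

noncomputable section

namespace Summit.Parity.GeneralizedHardyLittlewood.Theorems.EngineToPairs

namespace TIIOfX1

open Finset Real
open scoped ArithmeticFunction.sigma

/-! ### Summing the rectangles over the blocks -/

/-- Cauchy–Schwarz: `∑_{i<M} √y_i ≤ √M √(∑ y_i)`. [folklore] -/
theorem sum_sqrt_le (M : ℕ) (y : ℕ → ℝ) (hy : ∀ i, 0 ≤ y i) :
    ∑ i ∈ range M, Real.sqrt (y i) ≤ Real.sqrt M * Real.sqrt (∑ i ∈ range M, y i) := by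
  have h := Literature.NumberTheory.LFunctions.GaussianInt.sum_sqrt_mul_sqrt_le (range M)
    (x := fun _ => (1 : ℝ)) (y := y) (fun _ => zero_le_one) hy
  simp only [Real.sqrt_one, one_mul, sum_const, card_range, nsmul_eq_mul, mul_one] at h
  exact h

/-- The rectangle bounds summed over the blocks:
`∑_i √a_i √(D/w_i) G ≤ G √D · √M √(∑_i a_i/w_i)`. [folklore] -/
theorem rect_blocks_sum_le (M : ℕ) {D G : ℝ} (hD : 0 ≤ D) (hG : 0 ≤ G) (a w : ℕ → ℝ)
    (ha : ∀ i, 0 ≤ a i) (hw : ∀ i, 0 < w i) :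
    ∑ i ∈ range M, Real.sqrt (a i) * Real.sqrt (D / w i) * G ≤
      G * Real.sqrt D * (Real.sqrt M * Real.sqrt (∑ i ∈ range M, a i / w i)) := by
  have hterm : ∀ i ∈ range M, Real.sqrt (a i) * Real.sqrt (D / w i) * G =
      G * Real.sqrt D * Real.sqrt (a i / w i) := by
    intro i _
    rw [Real.sqrt_div hD, Real.sqrt_div (ha i)]
    have : Real.sqrt (w i) ≠ 0 := (Real.sqrt_pos.2 (hw i)).ne'
    field_simp
  rw [sum_congr rfl hterm, ← mul_sum]
  exact mul_le_mul_of_nonneg_left (sum_sqrt_le M (fun i => a i / w i)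
    (fun i => div_nonneg (ha i) (hw i).le)) (by positivity)

/-- The `m`-side: `m ≤ X/(1+η)^i` on block `i`, and the blocks recombine:
`∑_i (∑_{block i} ξ²)/(X/(1+η)^i) ≤ ∑_m ξ_m²/m`. [this line] -/
theorem blocks_msum_le {X η : ℝ} (Mlow : ℝ) (hX : 0 ≤ X) (hη : 0 ≤ η) {M : ℕ}
    (hM : X / (1 + η) ^ M < 1) (ξ : ℕ → ℝ) :
    ∑ i ∈ range M, (∑ m ∈ (Ioc ⌊X / (1 + η) ^ (i + 1)⌋₊ ⌊X / (1 + η) ^ i⌋₊).filter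
        (fun m : ℕ => Mlow < m), ξ m ^ 2) / (X / (1 + η) ^ i) ≤
      ∑ m ∈ (Icc 1 ⌊X⌋₊).filter (fun m : ℕ => Mlow < m), ξ m ^ 2 / m := by
  rw [sum_filter_blocks Mlow hX hη hM (fun m : ℕ => ξ m ^ 2 / m)]
  refine sum_le_sum fun i _ => ?_
  rw [sum_div]
  refine sum_le_sum fun m hm => ?_
  obtain ⟨hm1, hm2, -⟩ := mem_box hX hη hm
  have h0 : (0 : ℝ) ≤ X / (1 + η) ^ (i + 1) := by positivity
  have hm0 : (0 : ℝ) < m := lt_of_le_of_lt h0 hm1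
  exact div_le_div_of_nonneg_left (sq_nonneg _) hm0 hm2

/-- Arithmetic of the rectangle total: with `Y Y' = x`, `L ≥ 1`,
`(1+L) Y/(L_A L S) · (c Y' S) ≤ 2 c x / L_A`. [folklore] -/
theorem rect_arith {L Y Y' S c LA x : ℝ} (hL : 1 ≤ L) (hYY : Y * Y' = x) (hx : 0 ≤ x)
    (hS : 0 < S) (hLA : 0 < LA) (hc : 0 ≤ c) :
    (1 + L) * Y / (LA * L * S) * (c * Y' * S) ≤ 2 * c * x / LA := by
  have hL0 : 0 < L := by linarith
  have e : (1 + L) * Y / (LA * L * S) * (c * Y' * S) = c * (Y * Y') / LA * ((1 + L) / L) := by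
    field_simp
  rw [e, hYY]
  have h2 : (1 + L) / L ≤ 2 := by
    rw [div_le_iff₀ hL0]
    linarith
  have h0 : 0 ≤ c * x / LA := by positivity
  calc c * x / LA * ((1 + L) / L) ≤ c * x / LA * 2 := mul_le_mul_of_nonneg_left h2 h0
    _ = 2 * c * x / LA := by ring

/-! ### The band total -/

/-- The band terms of the Type-II sum are dominated by `∑_{k ∈ bands} τ(k − h) τ(k)^{2B+1}`.
[this line] -/
theorem band_total_le {h B : ℕ} {x η : ℝ} (X Mlow : ℝ) (hη : 0 ≤ η) (hη1 : η ≤ 1)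
    (hxh : (h : ℝ) < x / 2) (Qs : Finset ℕ) (ξ κ : ℕ → ℝ) (hξ : ∀ m, |ξ m| ≤ tauPow B m)
    (hκ : ∀ n, |κ n| ≤ tauPow B n) :
    ∑ q ∈ Qs, ∑ m ∈ (Icc 1 ⌊X⌋₊).filter (fun m : ℕ => Mlow < m),
        ∑ n ∈ (Icc 1 ⌊x⌋₊).filter (fun n : ℕ =>
          (x / 2 < ((m * n : ℕ) : ℝ) ∧ ((m * n : ℕ) : ℝ) ≤ (1 + η) * x / 2) ∨
          (x / (1 + η) < ((m * n : ℕ) : ℝ) ∧ ((m * n : ℕ) : ℝ) ≤ x)),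
          |ξ m * κ n * shiftWeight h q (m * n)| ≤
      ∑ k ∈ (Icc 1 ⌊x⌋₊).filter (fun k : ℕ =>
          (x / 2 < (k : ℝ) ∧ (k : ℝ) ≤ (1 + η) * x / 2) ∨ (x / (1 + η) < (k : ℝ) ∧ (k : ℝ) ≤ x)),
        ((σ 0 (k - h) : ℕ) : ℝ) * tauPow (2 * B + 1) k := by
  have h1η : (0 : ℝ) < 1 + η := by linarith
  have hx : 0 ≤ x := by
    have : (0 : ℝ) ≤ h := Nat.cast_nonneg h
    linarith
  have hband : ∀ k : ℕ, ((x / 2 < (k : ℝ) ∧ (k : ℝ) ≤ (1 + η) * x / 2) ∨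
      (x / (1 + η) < (k : ℝ) ∧ (k : ℝ) ≤ x)) → x / 2 < k ∧ (k : ℝ) ≤ x := by
    intro k hk
    rcases hk with ⟨h1, h2⟩ | ⟨h1, h2⟩
    · refine ⟨h1, h2.trans ?_⟩
      nlinarith
    · refine ⟨lt_of_le_of_lt ?_ h1, h2⟩
      rw [le_div_iff₀ h1η]
      nlinarith
  calc _ ≤ ∑ q ∈ Qs, ∑ m ∈ (Icc 1 ⌊X⌋₊).filter (fun m : ℕ => Mlow < m),
        ∑ n ∈ (Icc 1 ⌊x⌋₊).filter (fun n : ℕ =>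
          (x / 2 < ((m * n : ℕ) : ℝ) ∧ ((m * n : ℕ) : ℝ) ≤ (1 + η) * x / 2) ∨
          (x / (1 + η) < ((m * n : ℕ) : ℝ) ∧ ((m * n : ℕ) : ℝ) ≤ x)),
          tauPow B m * tauPow B n * |shiftWeight h q (m * n)| := by
        refine sum_le_sum fun q _ => sum_le_sum fun m _ => sum_le_sum fun n _ => ?_
        rw [abs_mul, abs_mul]
        have h1 := hξ m
        have h2 := hκ n
        have h3 := abs_nonneg (ξ m)
        have h4 := abs_nonneg (κ n)
        have h5 := abs_nonneg (shiftWeight h q (m * n))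
        have h6 : |ξ m| * |κ n| ≤ tauPow B m * tauPow B n := mul_le_mul h1 h2 h4 (h3.trans h1)
        exact mul_le_mul_of_nonneg_right h6 h5
    _ ≤ _ := by
        refine band_sum_le h B Qs ((Icc 1 ⌊X⌋₊).filter (fun m : ℕ => Mlow < m)) (Icc 1 ⌊x⌋₊)
          ((Icc 1 ⌊x⌋₊).filter (fun k : ℕ =>
            (x / 2 < (k : ℝ) ∧ (k : ℝ) ≤ (1 + η) * x / 2) ∨ (x / (1 + η) < (k : ℝ) ∧ (k : ℝ) ≤ x)))
          (fun k : ℕ => (x / 2 < (k : ℝ) ∧ (k : ℝ) ≤ (1 + η) * x / 2) ∨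
            (x / (1 + η) < (k : ℝ) ∧ (k : ℝ) ≤ x)) ?_ ?_
        · intro m _ n _ hP
          obtain ⟨h1, h2⟩ := hband (m * n) hP
          refine Finset.mem_filter.2 ⟨Finset.mem_Icc.2 ⟨?_, Nat.le_floor h2⟩, hP⟩
          have hpos : (0 : ℝ) < ((m * n : ℕ) : ℝ) := lt_of_le_of_lt (by positivity) h1
          have : (m * n : ℕ) ≠ 0 := by
            intro h0
            rw [h0] at hpos
            simp at hpos
          omega
        · intro k hk
          obtain ⟨h1, -⟩ := hband k (Finset.mem_filter.1 hk).2
          exact_mod_cast hxh.trans h1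


/-! ### The rectangle total -/

/-- **The rectangle total.**  Summing `rect_term_le` over the blocks `i < M ≤ 3L^{C'+1}` with the
saving `K = A + 1 + (2·2^{2B+1} + C' + 1)/2` gives `≤ 2√(3c₁c₃) · x (log x)^{−A}`. [this line] -/
theorem rect_total_le {h B M C' nn : ℕ} {x δ ε₁ η X Mlow K A c₁ c₃ : ℝ} (hx1 : 1 ≤ x) (hx2 : 2 ≤ x)
    (hδ : 0 < δ) (hδ1 : δ ≤ 1 / 2) (hε₁ : 0 ≤ ε₁) (hε₁' : ε₁ ≤ δ / 5) (hη : 0 < η) (hη1 : η ≤ 1)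
    (hX0 : 0 < X) (h2X : 2 * X ≤ x) (hXle : X ≤ x ^ (1 / 3 + δ))
    (hMlow : x ^ (2 * δ / 5) ≤ Mlow / 2) (hone : 1 ≤ x ^ (2 * δ / 5)) (hL1 : 1 ≤ Real.log x)
    (hM : X / (1 + η) ^ M < 1) (hMle : (M : ℝ) ≤ 3 * Real.log x ^ (C' + 1))
    (hnn : nn = 2 ^ (2 * B + 1) + (C' + 1) + 2 ^ (2 * B + 1)) (hK : K = A + 1 + (nn : ℝ) / 2)
    (hc₁ : 0 < c₁) (hc₃ : 0 < c₃)
    (hR1 : ∀ A : ℝ, x ^ (2 * δ / 5) ≤ A → A ≤ x ^ (1 / 3 + 2 * δ / 5) →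
      ∀ Q : ℝ, 1 ≤ Q → Q ≤ x ^ (2 * δ / 5 / 2) →
      ∀ Ra Cb : Finset ℕ, Ra ⊆ Ioc ⌊A⌋₊ ⌊2 * A⌋₊ → Cb ⊆ Icc 1 ⌊x / A⌋₊ → ∀ α β : ℕ → ℝ,
        ∑ q ∈ moduliH h Q, |∑ a ∈ Ra, ∑ b ∈ Cb, α a * β b * shiftWeight h q (a * b)| ≤
          Real.sqrt (∑ a ∈ Ra, α a ^ 2) * Real.sqrt (∑ b ∈ Cb, β b ^ 2) *
            ((1 + Real.log x) * x ^ (1 / 2 : ℝ) / Real.log x ^ K))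
    (hR2 : ∀ A : ℝ, x ^ δ ≤ A → A ≤ x ^ (1 / 3 + δ) →
      ∀ Q : ℝ, 1 ≤ Q → Q ≤ x ^ (δ / 2) →
      ∀ Ra Cb : Finset ℕ, Ra ⊆ Ioc ⌊A⌋₊ ⌊2 * A⌋₊ → Cb ⊆ Icc 1 ⌊x / A⌋₊ → ∀ α β : ℕ → ℝ,
        ∑ q ∈ moduliH h Q, |∑ a ∈ Ra, ∑ b ∈ Cb, α a * β b * shiftWeight h q (a * b)| ≤
          Real.sqrt (∑ a ∈ Ra, α a ^ 2) * Real.sqrt (∑ b ∈ Cb, β b ^ 2) *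
            ((1 + Real.log x) * x ^ (1 / 2 : ℝ) / Real.log x ^ K))
    (hτ1 : ∀ y : ℝ, 2 ≤ y →
      ∑ n ∈ Icc 1 ⌊y⌋₊, ((σ 0 n : ℕ) : ℝ) ^ (2 * B) ≤ c₁ * y * Real.log y ^ (2 ^ (2 * B + 1)))
    (hτ3 : ∀ y : ℝ, 2 ≤ y →
      ∑ n ∈ Icc 1 ⌊y⌋₊, ((σ 0 n : ℕ) : ℝ) ^ (2 * B) / n ≤ c₃ * Real.log y ^ (2 ^ (2 * B + 1)))
    (ξ κ : ℕ → ℝ) (hξ : ∀ m, |ξ m| ≤ tauPow B m) (hκ : ∀ n, |κ n| ≤ tauPow B n) :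
    ∑ i ∈ range M, ∑ q ∈ moduliH h (x ^ ε₁),
        |∑ m ∈ (Ioc ⌊X / (1 + η) ^ (i + 1)⌋₊ ⌊X / (1 + η) ^ i⌋₊).filter (fun m : ℕ => Mlow < m),
          ∑ n ∈ (Icc 1 ⌊x⌋₊).filter (fun n : ℕ =>
            x / (2 * (X / (1 + η) ^ (i + 1))) < n ∧ (n : ℝ) ≤ x / (X / (1 + η) ^ i)),
            ξ m * κ n * shiftWeight h q (m * n)| ≤
      2 * Real.sqrt (3 * c₁ * c₃) * x / Real.log x ^ A := by
  have hx0 : 0 < x := by linarith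
  have hLpos : 0 < Real.log x := by linarith
  have hXx : X ≤ x := by linarith
  have hD0 : 0 ≤ c₁ * x * Real.log x ^ (2 ^ (2 * B + 1)) := by positivity
  have hG0 : 0 ≤ (1 + Real.log x) * x ^ (1 / 2 : ℝ) / Real.log x ^ K := by positivity
  refine (sum_le_sum fun i _ => rect_term_le hx1 hδ hδ1 hε₁ hε₁' hη hη1 hX0
    h2X hXle hMlow hone hR1 hR2 hτ1 ξ κ hκ i).trans ?_
  refine (rect_blocks_sum_le M hD0 hG0
    (fun i => ∑ m ∈ (Ioc ⌊X / (1 + η) ^ (i + 1)⌋₊ ⌊X / (1 + η) ^ i⌋₊).filter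
      (fun m : ℕ => Mlow < m), ξ m ^ 2)
    (fun i => X / (1 + η) ^ i) (fun i => sum_nonneg fun _ _ => sq_nonneg _)
    (fun i => by positivity)).trans ?_
  have hmsum : ∑ i ∈ range M, (∑ m ∈ (Ioc ⌊X / (1 + η) ^ (i + 1)⌋₊ ⌊X / (1 + η) ^ i⌋₊).filter
      (fun m : ℕ => Mlow < m), ξ m ^ 2) / (X / (1 + η) ^ i) ≤
      c₃ * Real.log x ^ (2 ^ (2 * B + 1)) := by
    refine (blocks_msum_le Mlow hX0.le hη.le hM ξ).trans ?_
    refine (sum_sq_div_le_sum_sigma hξ ?_).trans (hτ3 x hx2)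
    intro m hm
    have hm' := Finset.mem_Icc.1 (Finset.mem_filter.1 hm).1
    exact Finset.mem_Icc.2 ⟨hm'.1, hm'.2.trans (Nat.floor_le_floor hXx)⟩
  have hcomb : Real.sqrt (c₁ * x * Real.log x ^ (2 ^ (2 * B + 1))) *
      (Real.sqrt (3 * Real.log x ^ (C' + 1)) *
        Real.sqrt (c₃ * Real.log x ^ (2 ^ (2 * B + 1)))) =
      Real.sqrt (3 * c₁ * c₃) * Real.sqrt x * Real.sqrt (Real.log x ^ nn) := by
    rw [← Real.sqrt_mul (by positivity), ← Real.sqrt_mul hD0,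
      ← Real.sqrt_mul (by positivity), ← Real.sqrt_mul (by positivity)]
    congr 1
    rw [hnn]
    ring
  have hYY : x ^ (1 / 2 : ℝ) * Real.sqrt x = x := by
    rw [← Real.sqrt_eq_rpow, Real.mul_self_sqrt hx0.le]
  have hLK : Real.log x ^ K = Real.log x ^ A * Real.log x * Real.sqrt (Real.log x ^ nn) := by
    have e1 : Real.sqrt (Real.log x ^ nn) = Real.log x ^ ((nn : ℝ) / 2) := by
      rw [Real.sqrt_eq_rpow, ← Real.rpow_natCast (Real.log x) nn, ← Real.rpow_mul hLpos.le]
      congr 1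
      ring
    rw [e1, hK, Real.rpow_add hLpos, Real.rpow_add hLpos, Real.rpow_one]
  calc (1 + Real.log x) * x ^ (1 / 2 : ℝ) / Real.log x ^ K *
        Real.sqrt (c₁ * x * Real.log x ^ (2 ^ (2 * B + 1))) *
        (Real.sqrt M * Real.sqrt (∑ i ∈ range M,
          (∑ m ∈ (Ioc ⌊X / (1 + η) ^ (i + 1)⌋₊ ⌊X / (1 + η) ^ i⌋₊).filter
            (fun m : ℕ => Mlow < m), ξ m ^ 2) / (X / (1 + η) ^ i)))
      ≤ (1 + Real.log x) * x ^ (1 / 2 : ℝ) / Real.log x ^ K *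
        Real.sqrt (c₁ * x * Real.log x ^ (2 ^ (2 * B + 1))) *
        (Real.sqrt (3 * Real.log x ^ (C' + 1)) *
          Real.sqrt (c₃ * Real.log x ^ (2 ^ (2 * B + 1)))) := by
        refine mul_le_mul_of_nonneg_left (mul_le_mul (Real.sqrt_le_sqrt hMle)
          (Real.sqrt_le_sqrt hmsum) (Real.sqrt_nonneg _) (Real.sqrt_nonneg _)) ?_
        positivity
    _ = (1 + Real.log x) * x ^ (1 / 2 : ℝ) /
          (Real.log x ^ A * Real.log x * Real.sqrt (Real.log x ^ nn)) *
        (Real.sqrt (3 * c₁ * c₃) * Real.sqrt x * Real.sqrt (Real.log x ^ nn)) := by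
        rw [mul_assoc, hcomb, hLK]
    _ ≤ 2 * Real.sqrt (3 * c₁ * c₃) * x / Real.log x ^ A :=
        rect_arith hL1 hYY hx0.le (Real.sqrt_pos.2 (pow_pos hLpos _))
          (Real.rpow_pos_of_pos hLpos _) (Real.sqrt_nonneg _)

/-- **The band total.**  With `η = (log x)^{−C'}`, `C' = ⌈2A⌉ + 2^5 + 2^{8B+5}`:
`∑_{k ∈ bands} τ(k − h) τ(k)^{2B+1} ≤ √(c₈(c₅+c₆)/2) · x (log x)^{−A}`, `c₈ = 2 + 2(C'+1)^{C'}`. [this line] -/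
theorem band_final_le {h B C' : ℕ} {x η A c₅ c₆ : ℝ} (hx1 : 1 ≤ x) (hx2 : 2 ≤ x)
    (hL1 : 1 ≤ Real.log x) (hxh : (h : ℝ) < x / 2) (hηdef : η = 1 / Real.log x ^ C')
    (hC' : C' = ⌈2 * A⌉₊ + (2 ^ (4 + 1) + 2 ^ (8 * B + 4 + 1))) (hc₅ : 0 < c₅) (hc₆ : 0 < c₆)
    (hτ5 : ∀ y : ℝ, 2 ≤ y →
      ∑ n ∈ Icc 1 ⌊y⌋₊, ((σ 0 n : ℕ) : ℝ) ^ 4 ≤ c₅ * y * Real.log y ^ (2 ^ (4 + 1)))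
    (hτ6 : ∀ y : ℝ, 2 ≤ y → ∑ n ∈ Icc 1 ⌊y⌋₊, ((σ 0 n : ℕ) : ℝ) ^ (8 * B + 4) ≤
      c₆ * y * Real.log y ^ (2 ^ (8 * B + 4 + 1))) :
    ∑ k ∈ (Icc 1 ⌊x⌋₊).filter (fun k : ℕ =>
        (x / 2 < (k : ℝ) ∧ (k : ℝ) ≤ (1 + η) * x / 2) ∨ (x / (1 + η) < (k : ℝ) ∧ (k : ℝ) ≤ x)),
      ((σ 0 (k - h) : ℕ) : ℝ) * tauPow (2 * B + 1) k ≤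
      Real.sqrt ((2 + 2 * ((C' : ℝ) + 1) ^ C') * (c₅ + c₆) / 2) * x / Real.log x ^ A := by
  have hx0 : 0 < x := by linarith
  have hLpos : 0 < Real.log x := by linarith
  have hLC : 0 < Real.log x ^ C' := pow_pos hLpos _
  have hη0 : 0 < η := by rw [hηdef]; positivity
  have hη1 : η ≤ 1 := by
    rw [hηdef, div_le_one hLC]
    exact one_le_pow₀ hL1
  have h1η : (0 : ℝ) < 1 + η := by linarith
  have hKsub : (Icc 1 ⌊x⌋₊).filter (fun k : ℕ =>
      (x / 2 < (k : ℝ) ∧ (k : ℝ) ≤ (1 + η) * x / 2) ∨ (x / (1 + η) < (k : ℝ) ∧ (k : ℝ) ≤ x)) ⊆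
      Icc 1 ⌊x⌋₊ := Finset.filter_subset _ _
  have hKh : ∀ k ∈ (Icc 1 ⌊x⌋₊).filter (fun k : ℕ =>
      (x / 2 < (k : ℝ) ∧ (k : ℝ) ≤ (1 + η) * x / 2) ∨ (x / (1 + η) < (k : ℝ) ∧ (k : ℝ) ≤ x)),
      h < k := by
    intro k hk
    have hP := (Finset.mem_filter.1 hk).2
    have hk2 : x / 2 < k := by
      rcases hP with ⟨h1, -⟩ | ⟨h1, -⟩
      · exact h1
      · exact lt_of_le_of_lt (div_le_div_of_nonneg_left hx0.le h1η (by linarith)) h1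
    exact_mod_cast hxh.trans hk2
  have hcard := card_band_le (x := x) (η := η) hx0.le hη0.le
  have hsq := band_sum_sq_le h B ((Icc 1 ⌊x⌋₊).filter (fun k : ℕ =>
      (x / 2 < (k : ℝ) ∧ (k : ℝ) ≤ (1 + η) * x / 2) ∨ (x / (1 + η) < (k : ℝ) ∧ (k : ℝ) ≤ x)))
  have hS0 : 0 ≤ ∑ k ∈ (Icc 1 ⌊x⌋₊).filter (fun k : ℕ =>
      (x / 2 < (k : ℝ) ∧ (k : ℝ) ≤ (1 + η) * x / 2) ∨ (x / (1 + η) < (k : ℝ) ∧ (k : ℝ) ≤ x)),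
      ((σ 0 (k - h) : ℕ) : ℝ) * tauPow (2 * B + 1) k :=
    sum_nonneg fun k _ => mul_nonneg (Nat.cast_nonneg _) (tauPow_nonneg _ _)
  have hin : ∑ k ∈ (Icc 1 ⌊x⌋₊).filter (fun k : ℕ =>
      (x / 2 < (k : ℝ) ∧ (k : ℝ) ≤ (1 + η) * x / 2) ∨ (x / (1 + η) < (k : ℝ) ∧ (k : ℝ) ≤ x)),
      ((((σ 0 (k - h) : ℕ) : ℝ)) ^ 4 + ((σ 0 k : ℕ) : ℝ) ^ (8 * B + 4)) / 2 ≤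
      (c₅ * x * Real.log x ^ (2 ^ (4 + 1)) + c₆ * x * Real.log x ^ (2 ^ (8 * B + 4 + 1))) / 2 := by
    rw [← sum_div, sum_add_distrib]
    refine div_le_div_of_nonneg_right (add_le_add ?_ ?_) (by norm_num)
    · exact (sum_sigma_shift_le h hKsub hKh).trans (hτ5 x hx2)
    · exact (sum_le_sum_of_subset_of_nonneg hKsub (fun _ _ _ => by positivity)).trans (hτ6 x hx2)
  have hgrow : 2 * η * x + 2 ≤ (2 + 2 * ((C' : ℝ) + 1) ^ C') * (η * x) := by
    have h1 : 1 ≤ ((C' : ℝ) + 1) ^ C' * (η * x) := by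
      rw [hηdef, show ((C' : ℝ) + 1) ^ C' * (1 / Real.log x ^ C' * x) =
        ((C' : ℝ) + 1) ^ C' * x / Real.log x ^ C' by ring, le_div_iff₀ hLC, one_mul]
      exact log_pow_le C' hx1
    have e : (2 + 2 * ((C' : ℝ) + 1) ^ C') * (η * x) =
        2 * η * x + 2 * (((C' : ℝ) + 1) ^ C' * (η * x)) := by ring
    rw [e]
    linarith
  have hLpow : c₅ * x * Real.log x ^ (2 ^ (4 + 1)) + c₆ * x * Real.log x ^ (2 ^ (8 * B + 4 + 1)) ≤
      (c₅ + c₆) * x * Real.log x ^ (2 ^ (4 + 1) + 2 ^ (8 * B + 4 + 1)) := by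
    have e1 : Real.log x ^ (2 ^ (4 + 1)) ≤ Real.log x ^ (2 ^ (4 + 1) + 2 ^ (8 * B + 4 + 1)) :=
      pow_le_pow_right₀ hL1 (Nat.le_add_right _ _)
    have e2 : Real.log x ^ (2 ^ (8 * B + 4 + 1)) ≤
        Real.log x ^ (2 ^ (4 + 1) + 2 ^ (8 * B + 4 + 1)) :=
      pow_le_pow_right₀ hL1 (Nat.le_add_left _ _)
    have f1 := mul_le_mul_of_nonneg_left e1 (by positivity : 0 ≤ c₅ * x)
    have f2 := mul_le_mul_of_nonneg_left e2 (by positivity : 0 ≤ c₆ * x)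
    have e : (c₅ + c₆) * x * Real.log x ^ (2 ^ (4 + 1) + 2 ^ (8 * B + 4 + 1)) =
        c₅ * x * Real.log x ^ (2 ^ (4 + 1) + 2 ^ (8 * B + 4 + 1)) +
          c₆ * x * Real.log x ^ (2 ^ (4 + 1) + 2 ^ (8 * B + 4 + 1)) := by ring
    rw [e]
    exact add_le_add f1 f2
  have hηL : η * Real.log x ^ (2 ^ (4 + 1) + 2 ^ (8 * B + 4 + 1)) ≤ 1 / (Real.log x ^ A) ^ 2 := by
    have e : η * Real.log x ^ (2 ^ (4 + 1) + 2 ^ (8 * B + 4 + 1)) =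
        1 / Real.log x ^ ⌈2 * A⌉₊ := by
      rw [hηdef, hC', pow_add]
      field_simp
    rw [e]
    refine one_div_le_one_div_of_le (by positivity) ?_
    rw [← Real.rpow_natCast (Real.log x ^ A) 2, ← Real.rpow_mul hLpos.le,
      ← Real.rpow_natCast (Real.log x) ⌈2 * A⌉₊]
    refine Real.rpow_le_rpow_of_exponent_le hL1 ?_
    push_cast
    have := Nat.le_ceil (2 * A)
    linarith
  have hfin : (∑ k ∈ (Icc 1 ⌊x⌋₊).filter (fun k : ℕ =>
      (x / 2 < (k : ℝ) ∧ (k : ℝ) ≤ (1 + η) * x / 2) ∨ (x / (1 + η) < (k : ℝ) ∧ (k : ℝ) ≤ x)),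
      ((σ 0 (k - h) : ℕ) : ℝ) * tauPow (2 * B + 1) k) ^ 2 ≤
      (Real.sqrt ((2 + 2 * ((C' : ℝ) + 1) ^ C') * (c₅ + c₆) / 2) * x / Real.log x ^ A) ^ 2 := by
    calc _ ≤ _ := hsq
      _ ≤ ((2 + 2 * ((C' : ℝ) + 1) ^ C') * (η * x)) * ((c₅ + c₆) * x *
          Real.log x ^ (2 ^ (4 + 1) + 2 ^ (8 * B + 4 + 1)) / 2) := by
          refine mul_le_mul (hcard.trans hgrow)
            (hin.trans (div_le_div_of_nonneg_right hLpow (by norm_num))) ?_ (by positivity)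
          exact sum_nonneg fun _ _ => by positivity
      _ = ((2 + 2 * ((C' : ℝ) + 1) ^ C') * (c₅ + c₆) / 2) * x ^ 2 *
          (η * Real.log x ^ (2 ^ (4 + 1) + 2 ^ (8 * B + 4 + 1))) := by ring
      _ ≤ ((2 + 2 * ((C' : ℝ) + 1) ^ C') * (c₅ + c₆) / 2) * x ^ 2 * (1 / (Real.log x ^ A) ^ 2) :=
          mul_le_mul_of_nonneg_left hηL (by positivity)
      _ = (Real.sqrt ((2 + 2 * ((C' : ℝ) + 1) ^ C') * (c₅ + c₆) / 2) * x / Real.log x ^ A) ^ 2 := by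
          rw [div_pow, mul_pow, Real.sq_sqrt (by positivity)]
          ring
  have hRHS0 : 0 ≤ Real.sqrt ((2 + 2 * ((C' : ℝ) + 1) ^ C') * (c₅ + c₆) / 2) * x / Real.log x ^ A := by
    positivity
  exact (pow_le_pow_iff_left₀ hS0 hRHS0 two_ne_zero).1 hfin

end TIIOfX1

/-- Anchor of part 5 of `stub_TII_of_X1`: Cauchy–Schwarz over the blocks, `∑ √y ≤ √M √(∑ y)`.
[this line] -/
theorem tiiOfX1_part5_anchor : ∀ (M : ℕ) (y : ℕ → ℝ), (∀ i, 0 ≤ y i) →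
    ∑ i ∈ Finset.range M, Real.sqrt (y i) ≤ Real.sqrt M * Real.sqrt (∑ i ∈ Finset.range M, y i) :=
  fun M y hy => TIIOfX1.sum_sqrt_le M y hy

end Summit.Parity.GeneralizedHardyLittlewood.Theorems.EngineToPairs

end
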